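/-
Copyright (c) 2026 the pub-hodgecm-mathlib formalisation cell (harness21).  Prover seat hodgecm-mathlib-K2E1-p02 (g6), Track B ∕ K2-LIT (build stream 29),
h413 = `stmt-HodgeConjecture-24833`, line `K2_E1_TraceFormulaBeta`, campaign «EIS-R7-BL-SPH-3», dealer K2E1-plan (g6) deal (47) «CAPSTONE₃ SKELETON» 2026-09-04T10:13:16Z:
the `N = 3` capstone «(H4-b)₃-sph on the Bernstein–Lapid road», HYPOTHESIS-FIRST on the named letters (L3) (continued constant-term scalar) and (L4) (regular remainder).
-/
import Summits.HodgeConjecture.HodgeConjecture.Theorems.K2E1SphericalEisensteinContinuationU2   -- ★ W5-A (K2-defs1): `differentiable_const_cpow_of_pos`, `continuousAt_of_differentiableOn` (the `N = 2` engine's tools)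
import Summits.HodgeConjecture.HodgeConjecture.Theorems.K2E1BorelEisensteinUDefs               -- ★ `eisensteinSeriesU`, `flatSectionU`
import Literature.NumberTheory.Automorphic.UnitaryGroupTorusSiegelIntegral                     -- ★ `borelHeight_pos`
import HarnessLib

/-!
# h413 ∕ Track B «K2-LIT», campaign «EIS-R7-BL-SPH-3» — file `K2E1SphericalEisensteinContinuationCMThreeOfLetters`: THE `N = 3` CAPSTONE SKELETON — MEROMORPHIC CONTINUATION OF THE
# SPHERICAL EISENSTEIN SERIES OF `U(2,1)_{L∕L⁺}` TO `{Re z > 1}` WITH ONE SIMPLE POLE AT `z = 2` AND CONSTANT RESIDUE, ON THE LETTERS (L3) ∕ (L4)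

Cell `pub/hodgecm-mathlib`, crux H413 = `stmt-HodgeConjecture-24833`, route of record `HCCMUnconditional`; chair K2-lead (g1), dealer K2E1-plan (g6) deal (47): the `N = 3` twin-by-assembly of
★ capstone (H4-b)₂-sph p858603 `sphericalEisenstein_continuation_cm_two` (K2E1SphericalEisensteinContinuationCMTwo.lean:110) with `2 ↦ 3`, `½ ↦ 1`, pole `1 ↦ 2`.  TARGET SHAPE (verbatim):
`∃ r ≠ 0, ∀ g, ∃ Ec, MeromorphicOn Ec {1 < re} ∧ DifferentiableOn ℂ Ec ({1 < re} ∖ {2}) ∧ (∀ z, 2 < z.re → Ec z = E(φ₀H^z)(g)) ∧ Tendsto (fun z => (z − 2) * Ec z) (𝓝[≠] 2) (𝓝 (φ₀ * r))`.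

CENSUS FINDING.  The `N = 2` engine ★ W5-A `spherical_continuation_of_inputs` is WHITTAKER-specific (letters `hWhol hWbd`, expansion `hE` with `κ·Σ_{ξ≠0} W̃`), but its complex-analytic core
is road-agnostic: «constant term `φ₀(h^z + c(z)h^{ρ₀−z})` + a remainder HOLOMORPHIC on `U`» ⟹ meromorphy on `U`, holomorphy off `ρ₀`, residue `φ₀·r` at `ρ₀` (`h^{ρ₀−z} → 1`).  §1 states and
proves that core ONCE (`continuation_of_constantTerm_add_regular`, any open `U ∋ ρ₀`).  On the Bernstein–Lapid road the remainder's holomorphy is exactly the analytic content that remains: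
(L4) «`E(φ₀H^z)(g) − φ₀(H(g)^z + c̃(z)H(g)^{2−z})` extends holomorphically to `{1 < Re z}`» — paid by the whole-plane B–L continuation (closer₃, K2E1-p10 (44)(c)) + the continued
constant term + the continued Maass–Selberg relation (★ p859140 MS-3, pairing supplier (40)∕(42)) + removability; it is carried here as the letter `hreg`.  (L3) = the scalar continuation
`c̃, r` of ★-pending W5₃-B (K2E4-p14 (23)∕(31): `MeromorphicOn c {1 < re}`, `DifferentiableOn c ({1 < re} ∖ {2})`, `(z − 2)·c z → r ≠ 0`).  THEOREMS ONLY (no `def`∕`instance`∕`notation`∕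
named-fact hypothesis∕`sorry`); lane `--kind proof --supports stmt-HodgeConjecture-24833 --as helper` (count-neutral).

* §1 (road- and rank-agnostic) **`continuation_of_constantTerm_add_regular (hU) (hρU : ρ₀ ∈ U) (hcmer hchol hcres) (hR : DifferentiableOn ℂ R U) (φ₀) (hh : 0 < h)`**: for
  `Ẽ(z) := φ₀(h^z + c(z)h^{ρ₀−z}) + R(z)` — `DifferentiableOn Ẽ (U ∖ {ρ₀})`, `MeromorphicOn Ẽ U`, `(z − ρ₀)Ẽ(z) → φ₀·r`.
* §2 (CM pair, `N = 3`, `ρ₀ = 2`, `U = {1 < re}`) **`sphericalEisenstein_continuation_cm_three_of_letters (c r hr hcmer hchol hcres) (φ₀) (hreg)`** : the TARGET SHAPE.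

HONEST LABEL.  Count-neutral helper; the head is CONDITIONAL on its displayed letters (L3) `c r …` and (L4) `hreg`; closes no socket; HC_CM is proved only modulo the 7 printed citations (2
remaining named inputs: hLiu418 = `stmt-HodgeConjecture-24832`, h413 = `stmt-HodgeConjecture-24833`) until rung 0 closes.

## References
* [MoeglinWaldspurger1995] C. Mœglin, J.-L. Waldspurger, *Spectral Decomposition and Eisenstein Series* (1995), IV.1.9–IV.1.11, IV.3.12.
* [BernsteinLapid2019] J. Bernstein, E. Lapid, *On the meromorphic continuation of Eisenstein series*, J. Amer. Math. Soc. 37 (2024), Thm 2.3, §4.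
* [Garrett2018] P. Garrett, *Modern Analysis of Automorphic Forms by Example* (2018), §1.10–§1.12, §11.3 (Maass–Selberg, pole control).
* [Langlands1976] R. P. Langlands, *On the Functional Equations Satisfied by Eisenstein Series*, LNM 544 (1976), §6.
-/

set_option autoImplicit false
-- the mandated namespace repeats `HodgeConjecture.HodgeConjecture`, as in every `Theorems/*.lean` of this sub-problem
set_option linter.dupNamespace false

noncomputable section

open scoped Topology NNReal
open NumberField IsDedekindDomain Set Filter
open Literature.NumberTheory.Automorphic Literature.NumberTheory.Automorphic.UnitaryGroup AdelicGroupData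
open Summit.HodgeConjecture.HodgeConjecture.Cruxes.H413.K2E1SphericalEisensteinContinuationU2 (differentiable_const_cpow_of_pos continuousAt_of_differentiableOn)
open Summit.HodgeConjecture.HodgeConjecture.Cruxes.H413.K2E1BorelEisensteinU

namespace Summit.HodgeConjecture.HodgeConjecture.Cruxes.H413.K2E1SphericalEisensteinContinuationCMThreeOfLetters

/-! ## §1 The road-agnostic engine: constant term plus a holomorphic remainder -/

/-- **THE ENGINE** (any open `U ∋ ρ₀`, any road): if `c` is meromorphic on `U`, holomorphic on `U ∖ {ρ₀}` with `(z − ρ₀)c(z) → r`, `R` is holomorphic on `U`, `h > 0`, then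
`Ẽ(z) := φ₀·(h^z + c(z)·h^{ρ₀−z}) + R(z)` is holomorphic on `U ∖ {ρ₀}`, meromorphic on `U`, and `(z − ρ₀)·Ẽ(z) → φ₀·r` (`h^{ρ₀−z} → h^0 = 1`).  The `N = 2` Whittaker engine ★
`spherical_continuation_of_inputs` is the instance `ρ₀ = 1`, `R = κ·Σ_{ξ≠0} W̃(·, ξ)`. [cite: Garrett2018, §1.10–§1.12] [cite: MoeglinWaldspurger1995, IV.1.11] -/
theorem continuation_of_constantTerm_add_regular {U : Set ℂ} (hU : IsOpen U) {ρ₀ : ℂ} (hρU : ρ₀ ∈ U)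
    {c : ℂ → ℂ} (hcmer : MeromorphicOn c U) (hchol : DifferentiableOn ℂ c (U \ {ρ₀})) {r : ℂ} (hcres : Tendsto (fun z : ℂ => (z - ρ₀) * c z) (𝓝[≠] ρ₀) (𝓝 r))
    {R : ℂ → ℂ} (hR : DifferentiableOn ℂ R U) (φ₀ : ℂ) {h : ℝ} (hh : 0 < h) :
    DifferentiableOn ℂ (fun z => φ₀ * (((h : ℝ) : ℂ) ^ z + c z * ((h : ℝ) : ℂ) ^ (ρ₀ - z)) + R z) (U \ {ρ₀}) ∧
    MeromorphicOn (fun z => φ₀ * (((h : ℝ) : ℂ) ^ z + c z * ((h : ℝ) : ℂ) ^ (ρ₀ - z)) + R z) U ∧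
    Tendsto (fun z : ℂ => (z - ρ₀) * (φ₀ * (((h : ℝ) : ℂ) ^ z + c z * ((h : ℝ) : ℂ) ^ (ρ₀ - z)) + R z)) (𝓝[≠] ρ₀) (𝓝 (φ₀ * r)) := by
  have hp1 : Differentiable ℂ fun z : ℂ => ((h : ℝ) : ℂ) ^ z := differentiable_const_cpow_of_pos hh
  have hp2 : Differentiable ℂ fun z : ℂ => ((h : ℝ) : ℂ) ^ (ρ₀ - z) :=
    fun z => ((differentiableAt_const ρ₀).sub differentiableAt_id).const_cpow (Or.inl (by exact_mod_cast hh.ne'))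
  -- (a) holomorphy off `ρ₀`
  have ha : DifferentiableOn ℂ (fun z => φ₀ * (((h : ℝ) : ℂ) ^ z + c z * ((h : ℝ) : ℂ) ^ (ρ₀ - z)) + R z) (U \ {ρ₀}) :=
    ((hp1.differentiableOn.add (hchol.mul hp2.differentiableOn)).const_mul φ₀).add (hR.mono fun z hz => hz.1)
  -- (a′) meromorphy on `U`
  have ha' : MeromorphicOn (fun z => φ₀ * (((h : ℝ) : ℂ) ^ z + c z * ((h : ℝ) : ℂ) ^ (ρ₀ - z)) + R z) U :=
    (((hp1.differentiableOn.analyticOnNhd hU).meromorphicOn.fun_add (hcmer.fun_mul (hp2.differentiableOn.analyticOnNhd hU).meromorphicOn)).const_smul φ₀ |>.congr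
      (fun z _ => by simp only [Pi.smul_apply, smul_eq_mul]) hU).fun_add (hR.analyticOnNhd hU).meromorphicOn
  refine ⟨ha, ha', ?_⟩
  -- (c) the residue at `ρ₀`
  have hRc : ContinuousAt R ρ₀ := continuousAt_of_differentiableOn hU hR hρU
  have hz1 : Tendsto (fun z : ℂ => z - ρ₀) (𝓝[≠] ρ₀) (𝓝 0) := by
    have h0 : Tendsto (fun z : ℂ => z - ρ₀) (𝓝 ρ₀) (𝓝 (ρ₀ - ρ₀)) := (continuous_id.sub continuous_const).tendsto ρ₀
    rw [sub_self] at h0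
    exact h0.mono_left nhdsWithin_le_nhds
  have hc1 : Tendsto (fun z : ℂ => ((h : ℝ) : ℂ) ^ z) (𝓝[≠] ρ₀) (𝓝 (((h : ℝ) : ℂ) ^ ρ₀)) := (hp1 ρ₀).continuousAt.tendsto.mono_left nhdsWithin_le_nhds
  have hc2 : Tendsto (fun z : ℂ => ((h : ℝ) : ℂ) ^ (ρ₀ - z)) (𝓝[≠] ρ₀) (𝓝 (((h : ℝ) : ℂ) ^ (ρ₀ - ρ₀))) := (hp2 ρ₀).continuousAt.tendsto.mono_left nhdsWithin_le_nhds
  have hc3 : Tendsto R (𝓝[≠] ρ₀) (𝓝 (R ρ₀)) := hRc.tendsto.mono_left nhdsWithin_le_nhds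
  have hlim := (((hz1.mul hc1).const_mul φ₀).add ((hcres.mul hc2).const_mul φ₀)).add (hz1.mul hc3)
  simp only [sub_self, Complex.cpow_zero, zero_mul, mul_zero, zero_add, mul_one, add_zero] at hlim
  refine hlim.congr fun z => ?_
  ring

/-! ## §2 The `N = 3` capstone on the letters (L3) `c, r` and (L4) `hreg` -/

section CM

variable (L : Type) [Field L] [NumberField L] [IsCMField L]

/-- **«(H4-b)₃-sph» ON THE BERNSTEIN–LAPID ROAD, HYPOTHESIS-FIRST** (dealer (47) target shape, verbatim): given the continued constant-term scalar (L3) `c` — meromorphic on `{1 < Re z}`,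
holomorphic off `z = 2`, `(z − 2)·c(z) → r ≠ 0` (W5₃-B) — and the regular-remainder letter (L4) `hreg` — for every `g` a function `R_g` HOLOMORPHIC on `{1 < Re z}` with
`E(φ₀H^z)(g) = φ₀·(H(g)^z + c(z)·H(g)^{2−z}) + R_g(z)` for `Re z > 2` (the continued constant term (Ξ₂)₃ plus «poles of `Ẽ_g` on `{1 < re}` are those of `c̃`», [MW] IV.3.12 (b) via the
continued Maass–Selberg relation ★ MS-3 and the whole-plane B–L continuation) —, there is ONE `r ≠ 0` such that for EVERY `g`, `z ↦ E(φ₀H^z)(g)` has a continuation `Ẽ_g` MEROMORPHIC on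
`{1 < Re z}`, HOLOMORPHIC on `{1 < Re z} ∖ {2}`, equal to `E(φ₀H^z)(g)` for `Re z > 2`, with `(z − 2)·Ẽ_g(z) → φ₀·r`.  Proof: §1 at `ρ₀ = 2`, `U = {1 < re}`, `h = H(g) > 0`.
[cite: MoeglinWaldspurger1995, IV.1.9–IV.1.11, IV.3.12] [cite: BernsteinLapid2019, Thm 2.3] [cite: Garrett2018, §11.3] -/
theorem sphericalEisenstein_continuation_cm_three_of_letters
    (c : ℂ → ℂ) (r : ℂ) (hr : r ≠ 0) (hcmer : MeromorphicOn c {z : ℂ | 1 < z.re}) (hchol : DifferentiableOn ℂ c ({z : ℂ | 1 < z.re} \ {2}))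
    (hcres : Tendsto (fun z : ℂ => (z - 2) * c z) (𝓝[≠] 2) (𝓝 r)) (φ₀ : ℂ)
    (hreg : ∀ g : (quasiSplit (↥(maximalRealSubfield L)) L (IsCMField.complexConj L) 3).Adelic, ∃ R : ℂ → ℂ, DifferentiableOn ℂ R {z : ℂ | 1 < z.re} ∧
      ∀ z : ℂ, 2 < z.re → eisensteinSeriesU (flatSectionU (fun _ : (quasiSplit (↥(maximalRealSubfield L)) L (IsCMField.complexConj L) 3).Adelic => φ₀) z) g =
        φ₀ * ((((borelHeight g : ℝ≥0) : ℝ) : ℂ) ^ z + c z * (((borelHeight g : ℝ≥0) : ℝ) : ℂ) ^ ((2 : ℂ) - z)) + R z) :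
    ∃ r : ℂ, r ≠ 0 ∧ ∀ g : (quasiSplit (↥(maximalRealSubfield L)) L (IsCMField.complexConj L) 3).Adelic, ∃ Ec : ℂ → ℂ,
      MeromorphicOn Ec {z : ℂ | 1 < z.re} ∧ DifferentiableOn ℂ Ec ({z : ℂ | 1 < z.re} \ {2}) ∧
      (∀ z : ℂ, 2 < z.re → Ec z = eisensteinSeriesU (flatSectionU (fun _ : (quasiSplit (↥(maximalRealSubfield L)) L (IsCMField.complexConj L) 3).Adelic => φ₀) z) g) ∧
      Tendsto (fun z : ℂ => (z - 2) * Ec z) (𝓝[≠] 2) (𝓝 (φ₀ * r)) := by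
  have hU : IsOpen {z : ℂ | 1 < z.re} := isOpen_lt continuous_const Complex.continuous_re
  have h2U : (2 : ℂ) ∈ {z : ℂ | 1 < z.re} := by
    show (1 : ℝ) < (2 : ℂ).re
    norm_num
  refine ⟨r, hr, fun g => ?_⟩
  obtain ⟨R, hR, hE⟩ := hreg g
  have hh : (0 : ℝ) < ((borelHeight g : ℝ≥0) : ℝ) := NNReal.coe_pos.2 (borelHeight_pos g)
  obtain ⟨ha, ha', hlim⟩ := continuation_of_constantTerm_add_regular hU h2U hcmer hchol hcres hR φ₀ hh
  exact ⟨_, ha', ha, fun z hz => (hE z hz).symm, hlim⟩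

end CM

end Summit.HodgeConjecture.HodgeConjecture.Cruxes.H413.K2E1SphericalEisensteinContinuationCMThreeOfLetters

end
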